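import Literature.Topology.FourManifolds.RasmussenProofs
import Literature.Topology.FourManifolds.LeeRasmussenProofs
import Literature.Topology.FourManifolds.SliceRibbonIsotopyProofs
import HarnessLib

/-!
# Slice knots have `s = 0`: the assembly of Rasmussen's argument (sibling of `Rasmussen.lean`)

Second sibling proof file for the named fact
`Literature.Topology.FourManifolds.eq_zero_of_isSmoothlySlice` of `Rasmussen.lean` (`s(K) = 0`
for a smoothly slice knot `K`; Rasmussen (2010), Thm. 1, the case `g_* = 0`), next to
`RasmussenProofs.lean` (which reduces the fact to either form of Rasmussen's Theorem 1,
`abs_le_two_mul_sliceGenus` / `HasRasmussenInvariant.eq_of_isConcordant`, both still named facts).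
Everything here is **proved**; no definition and no named fact is introduced (D-0026).

Rasmussen's proof of Theorem 1 (2010, §4, the paragraph after Cor. 4.2, p. 10 of
arXiv:math/0402131) for a slice disc, read as a concordance `C` from `K` to the unknot `U`:
*"`φ_C` is a filtered map of filtered degree `0`; `φ_C(x)` is nonzero for `x ≠ 0`
(Prop. 4.1 with Lee's basis); hence `s(φ_C(x)) ≥ s(x)` and `s_max(U) ≥ s_max(K)`"*, and
symmetrically for the reversed concordance, so `s_max(K) = s_max(U) = 1` and `s(K) = 0`.
This file isolates, sorry-free, the two ends of that argument which do **not** depend on the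
(absent) maps on Lee homology induced by link cobordisms:

* `GaussDiagram.leeSMax_eq_of_filtered`, `GaussDiagram.rasmussenInvariant_eq_of_filtered` —
  the algebraic sandwich: maps of degree-zero Lee cycles in both directions which kill no
  nonzero homology class and do not decrease the filtration degree `qMin` force
  `s_max(G) = s_max(G')`, hence `s(G) = s(G')` (twice `GaussDiagram.leeSMax_le_of_filtered` of
  `LeeRasmussenProofs.lean`, Rasmussen (2010), §2.2 and Def. 3.1);
* `GaussDiagram.rasmussenInvariant_eq_zero_of_filtered_empty` — in particular such maps to and
  from the empty diagram (the round unknot, `s_max = 1`, `rasmussenInvariant_empty`) force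
  `s(G) = 0`;
* `eq_zero_of_isSmoothlySlice_of_diagram` — the knot-level fact reduces to its diagrammatic
  core *"every regular projection of a smoothly slice knot reads a Gauss diagram with `s = 0`"*:
  `HasRasmussenInvariant` quantifies over isotopic representatives, and smooth sliceness is an
  isotopy invariant (`Knot.IsSmoothlySlice.of_isIsotopic_holds`, `SliceRibbonIsotopyProofs.lean`);
* `eq_zero_of_isSmoothlySlice_of_filtered` — **the assembly**: the named fact
  `eq_zero_of_isSmoothlySlice` follows as soon as every regular projection `P` of a smoothly
  slice knot comes with maps of degree-zero Lee cycles `P.diagram ⇄ GaussDiagram.empty` that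
  are injective on homology classes and filtered of degree `≥ 0`. In Rasmussen's proof these
  are the maps `φ_C`, `φ_{C̄}` of the concordance `C : K → U` cut out of the slice disc and of
  its reverse, presented as movies of Reidemeister and Morse moves ending at the crossingless
  diagram of the round unknot (Rasmussen (2010), §4: filtered degree `χ(C) = 0`, eq. (4.1);
  non-vanishing on Lee's canonical classes, Prop. 4.1; Lee's basis, §2.4). Those maps live on
  Lee complexes of *link* diagrams (a saddle changes the number of components), which the tree
  does not have yet (`GaussDiagram` is knots-only); this theorem is the exact interface they
  have to meet.

## References

* J. Rasmussen, *Khovanov homology and the slice genus*, Invent. Math. 182 (2010) 419–447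
  (arXiv:math/0402131): Thm. 1 (p. 2), §2.2 (filtered maps; the induced filtration on
  homology), Def. 3.1 (`s_min`, `s_max`), Def. 3.4 (`s = s_max - 1`), §4 (cobordisms:
  eq. (4.1), Prop. 4.1, Cor. 4.2, proof of Thm. 1 on p. 10: `s_max(U) = 1`,
  `s(φ_S(x)) ≥ s(x) - 2g`). [cite: Rasmussen2010, Thm. 1]
* E. S. Lee, *An endomorphism of the Khovanov invariant*, Adv. Math. 197 (2005), Thm. 4.2.
* C. Livingston, *A survey of classical knot concordance* (2005), §2.1 (sliceness is a property
  of the knot type). [cite: Livingston2005, §2.1]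

## Design notes

No definitions, no named facts, no instances; the hypotheses of the two conditional theorems
are stated with the tree's own objects (`GaussDiagram.leeCycles`, `GaussDiagram.LeeHomologyZero`,
`GaussDiagram.qMin`, `Knot.RegularProjection`) in exactly the shape consumed by
`GaussDiagram.leeSMax_le_of_filtered`.
-/

open Function Set

noncomputable section

namespace Literature.Topology.FourManifolds

namespace GaussDiagram

variable {G G' : GaussDiagram}

/-! ## The algebraic sandwich -/

/-- **Filtered maps in both directions pin down `s_max`.** If `φ : Z⁰(G) → Z⁰(G')` and
`ψ : Z⁰(G') → Z⁰(G)` are maps of degree-zero Lee cycles, each killing no nonzero homology class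
and not decreasing the filtration degree `qMin`, then `s_max(G) = s_max(G')`.
Rasmussen (2010), §2.2 (a filtered chain map of degree `k` induces a filtered map of degree `k`
on homology), Def. 3.1, and the proof of Thm. 1 in §4 (p. 10). [cite: Rasmussen2010, §2.2] -/
theorem leeSMax_eq_of_filtered (φ : G.leeCycles → G'.leeCycles) (ψ : G'.leeCycles → G.leeCycles)
    (hφ : ∀ z : G.leeCycles, (Submodule.Quotient.mk (φ z) : G'.LeeHomologyZero) = 0 →
      (Submodule.Quotient.mk z : G.LeeHomologyZero) = 0)
    (hφq : ∀ z : G.leeCycles, qMin z.1 ≤ qMin (φ z).1)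
    (hψ : ∀ z : G'.leeCycles, (Submodule.Quotient.mk (ψ z) : G.LeeHomologyZero) = 0 →
      (Submodule.Quotient.mk z : G'.LeeHomologyZero) = 0)
    (hψq : ∀ z : G'.leeCycles, qMin z.1 ≤ qMin (ψ z).1) :
    G.leeSMax = G'.leeSMax :=
  le_antisymm (leeSMax_le_of_filtered φ hφ hφq) (leeSMax_le_of_filtered ψ hψ hψq)

/-- **Filtered maps in both directions pin down `s`.** Under the hypotheses of
`leeSMax_eq_of_filtered` the two Gauss diagrams have the same Rasmussen invariant
`s = s_max - 1`. This is the form in which Rasmussen's Theorem 1 yields concordance invariance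
of `s`: the maps are induced by a concordance and its reverse. Rasmussen (2010), Def. 3.4,
Thm. 1, §4 (p. 10). [cite: Rasmussen2010, Thm. 1] -/
theorem rasmussenInvariant_eq_of_filtered (φ : G.leeCycles → G'.leeCycles)
    (ψ : G'.leeCycles → G.leeCycles)
    (hφ : ∀ z : G.leeCycles, (Submodule.Quotient.mk (φ z) : G'.LeeHomologyZero) = 0 →
      (Submodule.Quotient.mk z : G.LeeHomologyZero) = 0)
    (hφq : ∀ z : G.leeCycles, qMin z.1 ≤ qMin (φ z).1)
    (hψ : ∀ z : G'.leeCycles, (Submodule.Quotient.mk (ψ z) : G.LeeHomologyZero) = 0 →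
      (Submodule.Quotient.mk z : G'.LeeHomologyZero) = 0)
    (hψq : ∀ z : G'.leeCycles, qMin z.1 ≤ qMin (ψ z).1) :
    G.rasmussenInvariant = G'.rasmussenInvariant := by
  rw [rasmussenInvariant, rasmussenInvariant, leeSMax_eq_of_filtered φ ψ hφ hφq hψ hψq]

/-- **Filtered maps to and from the unknot force `s = 0`.** If a Gauss diagram `G` admits maps
of degree-zero Lee cycles to and from the empty diagram (the crossingless round unknot), each
killing no nonzero homology class and not decreasing `qMin`, then `s(G) = 0`: by the sandwich
`s_max(G) = s_max(U) = 1` (`leeSMax_empty`), so `s(G) = s(U) = 0` (`rasmussenInvariant_empty`).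
This is the last step of Rasmussen's proof of Thm. 1 for a slice disc: *"by Corollary 4.2,
`φ_S(x)` is nonzero; since `s_max(U) = 1` and `φ_S` is filtered of degree `-2g`,
`s(x) - 2g ≤ 1`"* with `g = 0`, and symmetrically. Rasmussen (2010), §4, proof of Thm. 1
(p. 10). [cite: Rasmussen2010, Thm. 1] -/
theorem rasmussenInvariant_eq_zero_of_filtered_empty
    (φ : G.leeCycles → GaussDiagram.empty.leeCycles)
    (ψ : GaussDiagram.empty.leeCycles → G.leeCycles)
    (hφ : ∀ z : G.leeCycles,
      (Submodule.Quotient.mk (φ z) : GaussDiagram.empty.LeeHomologyZero) = 0 →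
      (Submodule.Quotient.mk z : G.LeeHomologyZero) = 0)
    (hφq : ∀ z : G.leeCycles, qMin z.1 ≤ qMin (φ z).1)
    (hψ : ∀ z : GaussDiagram.empty.leeCycles,
      (Submodule.Quotient.mk (ψ z) : G.LeeHomologyZero) = 0 →
      (Submodule.Quotient.mk z : GaussDiagram.empty.LeeHomologyZero) = 0)
    (hψq : ∀ z : GaussDiagram.empty.leeCycles, qMin z.1 ≤ qMin (ψ z).1) :
    G.rasmussenInvariant = 0 :=
  (rasmussenInvariant_eq_of_filtered φ ψ hφ hφq hψ hψq).trans rasmussenInvariant_empty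

end GaussDiagram

/-! ## The knot-level fact from its diagrammatic core -/

/-- **Reduction of `eq_zero_of_isSmoothlySlice` to regular projections of slice knots.** If
every regular projection `P` of every smoothly slice knot reads a Gauss diagram with vanishing
Rasmussen invariant, then the named fact `eq_zero_of_isSmoothlySlice` holds: a witness of
`K.HasRasmussenInvariant s` is a regular projection of a knot `K'` isotopic to `K`, and `K'` is
smoothly slice with `K` (`Knot.IsSmoothlySlice.of_isIsotopic_holds`; Livingston (2005), §2.1:
sliceness is a property of the knot type). Rasmussen (2010), Thm. 1 (the statement is about
knot types; `s` is read on any diagram, Def. 3.4). [cite: Rasmussen2010, Thm. 1] -/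
theorem eq_zero_of_isSmoothlySlice_of_diagram
    (h : ∀ {K : Knot} (P : K.RegularProjection), K.IsSmoothlySlice →
      P.diagram.rasmussenInvariant = 0) :
    eq_zero_of_isSmoothlySlice := by
  rintro K s ⟨K', D, hKK', ⟨P, rfl⟩, rfl⟩ hs
  exact h P (Knot.IsSmoothlySlice.of_isIsotopic_holds hKK' hs)

/-- **The assembly of Rasmussen's argument for slice knots.** Suppose that for every regular
projection `P` of every smoothly slice knot `K` there are maps of degree-zero Lee cycles
`φ : Z⁰(P.diagram) → Z⁰(U)` and `ψ : Z⁰(U) → Z⁰(P.diagram)`, `U = GaussDiagram.empty` the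
crossingless diagram of the round unknot, each killing no nonzero Lee homology class and not
decreasing the filtration degree `qMin` — in Rasmussen's proof, the maps `φ_C` and `φ_{C̄}`
induced on Lee homology by the concordance `C` from `K` to the unknot cut out of a slice disc
and by its reverse, which are filtered of degree `χ(C) = 0` (§4, eq. (4.1)) and take Lee's
canonical basis classes to nonzero multiples of canonical classes (Prop. 4.1, Cor. 4.2, §2.4).
Then every smoothly slice knot has `s = 0`, i.e. the named fact `eq_zero_of_isSmoothlySlice`
holds (`rasmussenInvariant_eq_zero_of_filtered_empty` and
`eq_zero_of_isSmoothlySlice_of_diagram`). Rasmussen (2010), Thm. 1 and its proof, §4 (p. 10 of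
arXiv:math/0402131). [cite: Rasmussen2010, Thm. 1] -/
theorem eq_zero_of_isSmoothlySlice_of_filtered
    (h : ∀ {K : Knot} (P : K.RegularProjection), K.IsSmoothlySlice →
      ∃ (φ : P.diagram.leeCycles → GaussDiagram.empty.leeCycles)
        (ψ : GaussDiagram.empty.leeCycles → P.diagram.leeCycles),
        (∀ z : P.diagram.leeCycles,
          (Submodule.Quotient.mk (φ z) : GaussDiagram.empty.LeeHomologyZero) = 0 →
          (Submodule.Quotient.mk z : P.diagram.LeeHomologyZero) = 0) ∧
        (∀ z : P.diagram.leeCycles, GaussDiagram.qMin z.1 ≤ GaussDiagram.qMin (φ z).1) ∧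
        (∀ z : GaussDiagram.empty.leeCycles,
          (Submodule.Quotient.mk (ψ z) : P.diagram.LeeHomologyZero) = 0 →
          (Submodule.Quotient.mk z : GaussDiagram.empty.LeeHomologyZero) = 0) ∧
        (∀ z : GaussDiagram.empty.leeCycles, GaussDiagram.qMin z.1 ≤ GaussDiagram.qMin (ψ z).1)) :
    eq_zero_of_isSmoothlySlice := by
  refine eq_zero_of_isSmoothlySlice_of_diagram fun P hs ↦ ?_
  obtain ⟨φ, ψ, hφ, hφq, hψ, hψq⟩ := h P hs
  exact GaussDiagram.rasmussenInvariant_eq_zero_of_filtered_empty φ ψ hφ hφq hψ hψq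

end Literature.Topology.FourManifolds
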